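import Literature.Geometry.Manifold.StabilityOfEmbeddings
import HarnessLib

/-!
# Injectivity near a compact set; local injectivity of maps with injective differential

Topic `Literature/Geometry/Manifold`; two folklore lemmas of differential topology used to
embed tubular neighbourhoods (Hirsch, *Differential Topology* (1976), Ch. 2 §1, Lemma 1.3 and
Ex. 7 of §1; cf. the proof of Ch. 4 §5 Thm. 5.1: *"an immersion which is injective on a compact
set is injective — indeed an embedding — on a neighbourhood of it"*):

* `exists_isOpen_injOn_of_isCompact` — a continuous map into a Hausdorff space which is
  injective on a compact set `K` and locally injective at each point of `K` is injective on an
  open neighbourhood of `K` — a `Continuous g` convenience form of Mathlib's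
  `Set.InjOn.exists_isOpen_superset`; `exists_isOpen_injOn_of_isCompact_of_continuousAt`
  — the pointwise-`ContinuousAt` form, i.e. Mathlib's lemma itself (deprecated alias, 2026-08-16);
* `exists_mem_nhds_injOn_of_injective_fderiv`, `exists_mem_nhds_injOn_of_injective_mfderiv` —
  a `C¹` map (from a finite-dimensional space, resp. a boundaryless manifold modelled on one)
  into a normed space whose differential at `x₀` is injective is injective on a neighbourhood
  of `x₀` (the differential is bounded below and the Taylor expansion is uniform).

Everything here is proved; no named facts.

## References

* M. W. Hirsch, *Differential Topology*, GTM 33 (1976), Ch. 2 §1, Lemma 1.3 and Exercise 7;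
  Ch. 4 §5, Thm. 5.1. [HirschDT1976]
-/

noncomputable section

open scoped Manifold ContDiff Topology
open Set Function Filter Metric

namespace Literature.Geometry.Manifold

/-! ### Injectivity on a neighbourhood of a compact set -/

section Compact

variable {X Y : Type*} [TopologicalSpace X] [TopologicalSpace Y] [T2Space Y]

/-- **Injectivity near a compact set.** A continuous map into a Hausdorff space which is
injective on a compact set `K` and injective on some neighbourhood of each point of `K` is
injective on an open neighbourhood of `K`. [cite: HirschDT1976, Ch. 2 §1 Ex. 7] -/
theorem exists_isOpen_injOn_of_isCompact {g : X → Y} {K : Set X} (hK : IsCompact K)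
    (hg : Continuous g) (hinj : InjOn g K) (hloc : ∀ x ∈ K, ∃ U ∈ 𝓝 x, InjOn g U) :
    ∃ O : Set X, IsOpen O ∧ K ⊆ O ∧ InjOn g O :=
  hinj.exists_isOpen_superset hK (fun _ _ ↦ hg.continuousAt) hloc

/-- **Injectivity near a compact set**, for maps continuous only at the points of `K`:
a map into a Hausdorff space which is continuous at each point of a compact set `K`, injective
on `K` and injective on some neighbourhood of each point of `K` is injective on an open
neighbourhood of `K`. This is exactly Mathlib's `Set.InjOn.exists_isOpen_superset`; the name is
kept (deprecated) for existing importers. [cite: HirschDT1976, Ch. 2 §1 Ex. 7] -/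
@[deprecated Set.InjOn.exists_isOpen_superset (since := "2026-08-16")]
theorem exists_isOpen_injOn_of_isCompact_of_continuousAt {g : X → Y} {K : Set X}
    (hK : IsCompact K) (hg : ∀ x ∈ K, ContinuousAt g x) (hinj : InjOn g K)
    (hloc : ∀ x ∈ K, ∃ U ∈ 𝓝 x, InjOn g U) :
    ∃ O : Set X, IsOpen O ∧ K ⊆ O ∧ InjOn g O :=
  hinj.exists_isOpen_superset hK hg hloc

end Compact

/-! ### Local injectivity from an injective differential -/

section Flat

variable {E F : Type*} [NormedAddCommGroup E] [NormedSpace ℝ E] [FiniteDimensional ℝ E]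
  [NormedAddCommGroup F] [NormedSpace ℝ F]

/-- **A `C¹` map with injective differential at `u₀` is injective near `u₀`** (flat version).
[cite: HirschDT1976, Ch. 2 §1 Lemma 1.3] -/
theorem exists_mem_nhds_injOn_of_injective_fderiv {g : E → F} {u₀ : E} {n : WithTop ℕ∞}
    (hg : ContDiffAt ℝ n g u₀) (hn : 1 ≤ n) (hinj : Injective (fderiv ℝ g u₀)) :
    ∃ U ∈ 𝓝 u₀, InjOn g U := by
  -- a continuous derivative `g'` on a neighbourhood `O` of `u₀`
  obtain ⟨g', O, hO, hcont, hderiv⟩ := contDiffAt_one_iff.1 (hg.of_le hn)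
  have hg'u₀ : g' u₀ = fderiv ℝ g u₀ := (hderiv u₀ (mem_of_mem_nhds hO)).fderiv.symm
  obtain ⟨K, hK, hA⟩ := exists_norm_le_mul_norm_of_injective (g' u₀) (by rw [hg'u₀]; exact hinj)
  have hcontAt : ContinuousAt g' u₀ := hcont.continuousAt hO
  have hball : ∀ᶠ u in 𝓝 u₀, ‖g' u - g' u₀‖ ≤ (2 * K)⁻¹ := by
    have h : ContinuousAt (fun u ↦ g' u - g' u₀) u₀ := hcontAt.sub continuousAt_const
    have h0 : ‖(fun u ↦ g' u - g' u₀) u₀‖ < (2 * K)⁻¹ := by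
      simp only [sub_self, norm_zero, inv_pos]; positivity
    exact (h.norm.eventually_lt continuousAt_const h0).mono fun u hu ↦ hu.le
  obtain ⟨r, hr, hrsub⟩ := Metric.eventually_nhds_iff_ball.1 (hball.and (hO : ∀ᶠ u in 𝓝 u₀, u ∈ O))
  refine ⟨ball u₀ r, ball_mem_nhds _ hr, fun u hu u' hu' heq ↦ ?_⟩
  have key := norm_sub_le_mul_norm_sub_of_hasFDerivWithinAt (g' := g') hK hA (convex_ball u₀ r)
    (fun w hw ↦ (hderiv w (hrsub w hw).2).hasFDerivWithinAt) (fun w hw ↦ (hrsub w hw).1) hu hu'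
  rw [heq, sub_self, norm_zero, mul_zero] at key
  exact sub_eq_zero.1 (norm_le_zero_iff.1 key)

end Flat

section Manifold

variable {E : Type*} [NormedAddCommGroup E] [NormedSpace ℝ E] [FiniteDimensional ℝ E]
  {H : Type*} [TopologicalSpace H] {I : ModelWithCorners ℝ E H} [I.Boundaryless]
  {M : Type*} [TopologicalSpace M] [ChartedSpace H M]
  {F : Type*} [NormedAddCommGroup F] [NormedSpace ℝ F]

/-- **A `C¹` map from a manifold into a normed space with injective differential at `x₀` is
injective on a neighbourhood of `x₀`.** [cite: HirschDT1976, Ch. 2 §1 Lemma 1.3] -/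
theorem exists_mem_nhds_injOn_of_injective_mfderiv {n : WithTop ℕ∞} [IsManifold I n M]
    {g : M → F} {x₀ : M} (hg : ContMDiffAt I 𝓘(ℝ, F) n g x₀) (hn : 1 ≤ n)
    (hinj : Injective (mfderiv I 𝓘(ℝ, F) g x₀)) : ∃ U ∈ 𝓝 x₀, InjOn g U := by
  haveI : IsManifold I 1 M := IsManifold.of_le hn
  set φ := extChartAt I x₀
  -- the chart representative `g ∘ φ⁻¹` is `C¹` at `φ x₀`
  have hsymm : ContMDiffWithinAt 𝓘(ℝ, E) I n φ.symm φ.target (φ x₀) :=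
    contMDiffOn_extChartAt_symm x₀ _ (φ.map_source (mem_extChartAt_source x₀))
  have hx₀ : φ.symm (φ x₀) = x₀ := extChartAt_to_inv x₀
  have hcomp : ContMDiffWithinAt 𝓘(ℝ, E) 𝓘(ℝ, F) n (g ∘ φ.symm) φ.target (φ x₀) :=
    (hx₀ ▸ hg).comp_contMDiffWithinAt _ hsymm
  have hflat : ContDiffAt ℝ n (g ∘ φ.symm) (φ x₀) :=
    (contMDiffWithinAt_iff_contDiffWithinAt.1 hcomp).contDiffAt
      ((isOpen_extChartAt_target x₀).mem_nhds (φ.map_source (mem_extChartAt_source x₀)))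
  -- its differential is `mfderiv g x₀`
  have hmd : MDifferentiableAt I 𝓘(ℝ, F) g x₀ := hg.mdifferentiableAt (by rintro rfl; simp at hn)
  have hderiv : mfderiv I 𝓘(ℝ, F) g x₀ = fderiv ℝ (g ∘ φ.symm) (φ x₀) := by
    rw [hmd.mfderiv, ModelWithCorners.Boundaryless.range_eq_univ, fderivWithin_univ]
    rfl
  have hinj' : Injective (fderiv ℝ (g ∘ φ.symm) (φ x₀)) := by
    intro a b hab
    exact hinj (by rw [hderiv]; exact hab)
  obtain ⟨U, hU, hUinj⟩ := exists_mem_nhds_injOn_of_injective_fderiv hflat hn hinj'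
  -- pull back to the manifold
  refine ⟨φ.source ∩ φ ⁻¹' U, ?_, ?_⟩
  · exact Filter.inter_mem (extChartAt_source_mem_nhds x₀)
      ((continuousAt_extChartAt x₀).preimage_mem_nhds hU)
  · intro x hx x' hx' heq
    have h1 : (g ∘ φ.symm) (φ x) = (g ∘ φ.symm) (φ x') := by
      simp only [comp_apply, φ.left_inv hx.1, φ.left_inv hx'.1, heq]
    have h2 := hUinj hx.2 hx'.2 h1
    rw [← φ.left_inv hx.1, ← φ.left_inv hx'.1, h2]

end Manifold

end Literature.Geometry.Manifold
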